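import Summits.AtomisticToContinuum.HydrodynamicLimit.Theses.CollisionIsometryCLT
import Summits.AtomisticToContinuum.HydrodynamicLimit.Theses.SpeedCapSurgery
import Literature.Analysis.FluidPDE.HardSphereCollisionRecord

/-!
# Sketch — first lemmas of the crux idea `pythagorean-mgf-transport` for `AprioriBounds`
(stmt-AtomisticToContinuum-9519), ideator 2 (gen 2), round 1.

The lever in one line: for an elastic collision with unit normal `ω`,
`⟪a, v⁺⟫ = ⟪a − ⟪a,ω⟫ω, v⁻⟫ + ⟪a,ω⟫ ⟪w,ω⟫` and `‖a‖² = ‖a − ⟪a,ω⟫ω‖² + ⟪a,ω⟫²`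
(`chernoff_splitting`, `chernoff_pythagoras`, PROVED): the Chernoff/Laplace vector of a Gaussian
tail bound splits ORTHOGONALLY at every collision (Bobylev's Fourier-variable Pythagoras, run for the
moment generating function), so the Gaussian exponent `Θ‖a‖²/2` is transported along collisions with
no loss; all slack sits in prefactors.  The remaining `def … : Prop` are the first checkable
statements of the line (not proved here; crux-ideate files no skeleton).
-/

set_option autoImplicit false

namespace Summit.AtomisticToContinuum.HydrodynamicLimit.Cruxes.AprioriBounds.IdeatorTwo.Transport

open scoped BigOperators ENNReal NNReal InnerProductSpace
open MeasureTheory Filter Set Topology Metric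
open Literature.Analysis.FluidPDE Literature.MathematicalPhysics.KineticTheory

section Algebra

variable {E : Type*} [NormedAddCommGroup E] [InnerProductSpace ℝ E]

/-- **Chernoff splitting (one collision).**  For the elastic law `collide ω (v, w)` and any test
vector `a`: `⟪a, v⁺⟫ = ⟪a − ⟪a,ω⟫ω, v⟫ + ⟪a,ω⟫·⟪w,ω⟫` — the post-collisional projection on `a`
is the pre-collisional projection on the COMPLEMENTARY vector `P_ω a = a − ⟪a,ω⟫ω` plus the
partner's normal velocity weighted by `⟪a,ω⟫`. -/
theorem chernoff_splitting (ω : sphere (0 : E) 1) (p : E × E) (a : E) :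
    ⟪a, (collide ω p).1⟫_ℝ =
      ⟪a - ⟪a, (ω : E)⟫_ℝ • (ω : E), p.1⟫_ℝ + ⟪a, (ω : E)⟫_ℝ * ⟪p.2, (ω : E)⟫_ℝ := by
  simp only [collide, inner_sub_right, real_inner_smul_right, inner_sub_left, real_inner_smul_left,
    real_inner_comm (ω : E)]
  ring

/-- **Pythagoras for the Chernoff vector.** `‖a‖² = ‖a − ⟪a,ω⟫ω‖² + ⟪a,ω⟫²` for a unit `ω`: the
Gaussian budget `Θ‖a‖²/2` of an mgf bound `E e^{⟪a,v⟫} ≤ B e^{Θ‖a‖²/2}` is split EXACTLY between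
the own pre-collisional factor (vector `P_ω a`) and the partner factor (scalar `⟪a,ω⟫`). -/
theorem chernoff_pythagoras (ω : sphere (0 : E) 1) (a : E) :
    ‖a‖ ^ 2 = ‖a - ⟪a, (ω : E)⟫_ℝ • (ω : E)‖ ^ 2 + ⟪a, (ω : E)⟫_ℝ ^ 2 := by
  have hω : ‖(ω : E)‖ = 1 := norm_eq_of_mem_sphere ω
  have h1 : ‖a - ⟪a, (ω : E)⟫_ℝ • (ω : E)‖ ^ 2 =
      ‖a‖ ^ 2 - 2 * ⟪a, ⟪a, (ω : E)⟫_ℝ • (ω : E)⟫_ℝ + ‖⟪a, (ω : E)⟫_ℝ • (ω : E)‖ ^ 2 :=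
    norm_sub_sq_real _ _
  have h2 : ⟪a, ⟪a, (ω : E)⟫_ℝ • (ω : E)⟫_ℝ = ⟪a, (ω : E)⟫_ℝ * ⟪a, (ω : E)⟫_ℝ :=
    real_inner_smul_right _ _ _
  have h3 : ‖⟪a, (ω : E)⟫_ℝ • (ω : E)‖ = |⟪a, (ω : E)⟫_ℝ| := by
    rw [norm_smul, hω, mul_one, Real.norm_eq_abs]
  rw [h1, h2, h3, sq_abs]
  ring

/-- **Energy bookkeeping of the same split** (sanity link to the kinematics used by the other
ideators): `‖v⁺‖² = ‖v‖² − ⟪v,ω⟫² + ⟪w,ω⟫²` is `chernoff_pythagoras` read on the velocity side; here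
only the consequence `‖v⁺‖² ≤ ‖v‖² + ‖w‖²` via conservation is recorded. -/
theorem post_sq_le_pair_energy (ω : sphere (0 : E) 1) (p : E × E) :
    ‖(collide ω p).1‖ ^ 2 ≤ ‖p.1‖ ^ 2 + ‖p.2‖ ^ 2 := by
  have h := norm_sq_collide_fst_add_norm_sq_collide_snd ω p
  nlinarith [sq_nonneg ‖(collide ω p).2‖]

end Algebra

/-- **Flux-tilted Gaussian mgf** (first checkable ANALYTIC statement; 1-D calculus, provable now):
the normal velocity of a partner drawn from the hard-sphere flux `|g − y| φ_Θ(y) dy` (φ_Θ = N(0,Θ),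
`g` = the tagged sphere's normal velocity) has moment generating function at most
`e^{Θc²/2} (1 + |c| √(πΘ/2))` times its mass: complete the square (`e^{cy}φ_Θ(y) = e^{Θc²/2}φ_Θ(y−Θc)`),
`|g − y − Θc| ≤ |g − y| + Θ|c|`, and `E|g − Y| ≥ E|Y| = √(2Θ/π)` (the median minimises the mean
absolute deviation).  The flux selection costs a LINEAR factor in `|c|`, never a change of the
Gaussian rate. -/
def FluxTiltedGaussianMGF : Prop :=
  ∀ (Θ : ℝ≥0) (g c : ℝ), Θ ≠ 0 →
    ∫ y, Real.exp (c * y) * |g - y| ∂(ProbabilityTheory.gaussianReal 0 Θ) ≤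
      Real.exp ((Θ : ℝ) * c ^ 2 / 2) * (1 + |c| * Real.sqrt (Real.pi * Θ / 2)) *
        ∫ y, |g - y| ∂(ProbabilityTheory.gaussianReal 0 Θ)

/-- **Tilt by envelope** (the `δ`-trick; provable now): for ANY finite law `ν` on `ℝ` with a
Gaussian mgf envelope `∫ e^{c'y} dν ≤ B e^{Θc'²/2}` (all `c'`), the flux weight `|y|` costs only
`∫ |y| e^{cy} dν ≤ (B/(eδ)) (e^{Θ(c+δ)²/2} + e^{Θ(c−δ)²/2})` for every `δ > 0`
(`|y| ≤ e^{δ|y|}/(eδ) ≤ (e^{δy} + e^{−δy})/(eδ)`); with `δ = 1/(Θ|c|)` the factor is `≍ Θ|c|·B·e^{Θc²/2}`,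
i.e. the envelope evaluated at levels shifted by `O(1)`.  This is what lets the transport run on a
SELF-CONSISTENT envelope (unknown law) instead of an exact Maxwellian. -/
def TiltByEnvelope : Prop :=
  ∀ (ν : Measure ℝ), IsFiniteMeasure ν → ∀ (B Θ c δ : ℝ), 0 < δ →
    (∀ c' : ℝ, Integrable (fun y => Real.exp (c' * y)) ν ∧
      ∫ y, Real.exp (c' * y) ∂ν ≤ B * Real.exp (Θ * c' ^ 2 / 2)) →
    ∫ y, |y| * Real.exp (c * y) ∂ν ≤
      B / (Real.exp 1 * δ) * (Real.exp (Θ * (c + δ) ^ 2 / 2) + Real.exp (Θ * (c - δ) ^ 2 / 2))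

/-- **Chip-averaging contraction** (the first THEOREM of the line; pure real analysis, provable now,
M–L sized).  Let `B̄(r) = Bb` for `r < Rb` and `B̄(r) = A r^{-p} e^{-εr}` for `r ≥ Rb`, with
`p ∈ (1/2, 1)`.  The one-collision transport operator — average over the chipped fraction
`u = cos²∠(a, ω)` of the budget `R = Θ²‖a‖²`, whose law under a uniform normal is `du/(2√u)`, of the
product of the partner prefactor `B̄(uR)` and the own prefactor `B̄((1−u)R)`, with the hard-sphere
flux tilt `(1 + √(uR/Θ))` and any constant slack `S` — satisfies `S·T[B̄](R) ≤ B̄(R)/2` for all large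
`R`: the boundary chips (`uR < Rb` or `(1−u)R < Rb`) contribute `O(R^{-1/2})·B̄(R)`, the bulk chips
`O(A R^{1/2−p})·B̄(R)`.  Constant slack per collision therefore costs NOTHING at high levels — it is
absorbed by the polynomial level weight, never by the Gaussian rate. -/
def ChipAveragingContraction : Prop :=
  ∀ (p S Θ ε Bb Rb A : ℝ), 1 / 2 < p → p < 1 → 0 ≤ S → 0 < Θ → 0 ≤ ε → 0 ≤ Bb → 0 < Rb → 0 < A →
    let Bbar : ℝ → ℝ := fun r => if r < Rb then Bb else A * r ^ (-p) * Real.exp (-ε * r)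
    ∃ Re : ℝ, ∀ R : ℝ, Re ≤ R →
      S * ∫ u in Ioo (0 : ℝ) 1,
          (1 + Real.sqrt (u * R / Θ)) * Bbar (u * R) * Bbar ((1 - u) * R) / (2 * Real.sqrt u)
        ≤ Bbar R / 2

/-- **Incoming ledger** (pathwise, provable now from `IsHardSphereTrajectory` piecewise free flight;
it is gen-1's `VelocityTelescoping` rearranged): along a good orbit, for every `ψ ≥ 0`, the sum of
`ψ` over INCOMING first-particle velocities of the collision records in `(0, t]` is at most the sum
over OUTGOING ones plus the initial content `Σᵢ ψ(vᵢ(0))` — each incoming velocity is the outgoing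
velocity of the same sphere's previous collision, or its initial velocity (exact multiset identity,
survivors dropped).  No rates, no sojourn times, no flight lengths enter. -/
def IncomingLedger : Prop :=
  ∀ (σ : ℝ) (N : ℕ)
    (Φ : HardSphereFlow (Torus.geometry (Fin 3)) (hsDiameter σ N) (N + 1))
    (ψ : V3 → ℝ), (∀ v, 0 ≤ ψ v) → ∀ z ∈ Φ.good,
      0 ∉ collisionTimes (Torus.geometry (Fin 3)) (hsDiameter σ N) (fun s => Φ.flow s z) →
      ∀ t : ℝ, 0 ≤ t →
        Φ.collisionSum (Ioc 0 t)
            (fun c : HardSphereCollisionRecord (Fin 3) T3 (N + 1) => ψ c.preVel.1) z ≤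
          Φ.collisionSum (Ioc 0 t)
            (fun c : HardSphereCollisionRecord (Fin 3) T3 (N + 1) => ψ c.postVel.1) z +
          ∑ i, ψ ((Φ.flow 0 z i).2)

/-- **The line's output, typed** (what the transport theorem delivers and the union bound turns into
the cap): a GAUSSIAN ENVELOPE OF THE COLLISION INPUT IN EXPECTATION — for some proxy `Θ` and
prefactor data, the local-Gibbs expectation of the number of collision records in `(0,t]` whose
incoming pair energy exceeds `R` is at most `K (N+1)^{4/3} R e^{-R/(2Θ)}` for ALL levels `R ≥ R₀`
(in particular at `R ≍ log N`).  Compare `SpeedCapSurgery.TailsToMaxSpeed`: this is exactly its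
missing input, with `GaussianVelocityTails` (stmt-4607, all levels, open) no longer assumed. -/
def GaussianInputEnvelope : Prop :=
  ∀ (a₀ θ₀ : T3 → ℝ) (u₀ : T3 → V3), Continuous a₀ → Continuous θ₀ → Continuous u₀ →
    (∀ x, 0 < a₀ x) → (∀ x, 0 < θ₀ x) → ∃ σ₀ : ℝ, 0 < σ₀ ∧ ∀ σ : ℝ, 0 < σ → σ < σ₀ →
    ∀ Φ : (N : ℕ) → HardSphereFlow (Torus.geometry (Fin 3)) (hsDiameter σ N) (N + 1),
    ∀ t : ℝ, 0 < t → ∃ Θ K R₀ : ℝ, 0 < Θ ∧ ∀ R : ℝ, R₀ ≤ R → ∀ N : ℕ,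
      ∫⁻ z, ENNReal.ofReal ((Φ N).collisionSum (Ioc 0 t)
          (fun c : HardSphereCollisionRecord (Fin 3) T3 (N + 1) =>
            if R < ‖c.preVel.1‖ ^ 2 + ‖c.preVel.2‖ ^ 2 then (1 : ℝ) else 0) z)
        ∂(localGibbsLaw σ a₀ u₀ θ₀ N (Φ N)) ≤
      ENNReal.ofReal (K * ((N : ℝ) + 1) ^ ((4 : ℝ) / 3) * R * Real.exp (-R / (2 * Θ)))

/-- **Docking** (pure logic + the union bound of `SpeedCapSurgery.TailsToMaxSpeed`, L-sized with the
measurability of the sup-event): the envelope gives the `√log N` speed cap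
`SpeedCapSurgery.MaxSpeedBoundLog` (stmt-9629) with constant `C² = (8/3 + δ)Θ`, because speeds
change only at collisions (`{∃ r ≤ t, ∃ i, |vᵢ(r)| > λ} ⊆ {max |vᵢ(0)| > λ} ∪ {some record in (0,t]
has incoming pair energy > λ²}`, `post_sq_le_pair_energy`) and
`K (N+1)^{4/3} λ² e^{-λ²/2Θ} → 0` at `λ² = (8/3+δ)Θ log(N+2)`. Stated as the implication to be
proved in crux-plan. -/
def EnvelopeGivesCap : Prop :=
  GaussianInputEnvelope →
    Summit.AtomisticToContinuum.HydrodynamicLimit.Theses.SpeedCapSurgery.MaxSpeedBoundLog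

end Summit.AtomisticToContinuum.HydrodynamicLimit.Cruxes.AprioriBounds.IdeatorTwo.Transport
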